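import Literature.NumberTheory.LFunctions.Zhang2022.Section12ShiftedSmallCircleOmega
import Literature.NumberTheory.LFunctions.Zhang2022.RepairGapSection12ShiftedSmallCirclePremise
import Literature.NumberTheory.LFunctions.Zhang2022.RepairGapLemma57Premise
import HarnessLib

/-!
# Zhang (2022), rescue GAP/BED (D-0124 (3)(4)): §12 Lemmas 12.2–12.3 — the small circle around `s = β₆ − w` WITH the Gaussian
# factor `ω₁` (the packaged `ω₁`-circle evaluation of `Z22:§12.u025` / `u030`) under the minimum premise `‖L(1,χ)‖ ≤ 𝓛⁻¹⁵`

Topic `Literature/NumberTheory/LFunctions/Zhang2022` (Landau–Siegel audit tree; verdict-neutral).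
Y. Zhang, *Discrete mean estimates and the Landau–Siegel zero*, arXiv:2211.02515v1 (2022)
[Zhang2022LandauSiegel] — **an unrefereed manuscript under adjudication; nothing in this file asserts or
denies its Theorems 1–2, and nothing here is a claim about Landau–Siegel zeros. The programme SEARCHES and
TYPES; no claim about Landau–Siegel zeros, Theorems 1–2 of arXiv:2211.02515 or a repaired Margin232 until a
kernel theorem says so.**

The tree file `Section12ShiftedSmallCircleOmega` (lane ZHANG-L, WP12) threads `hA : ‖L(1,χ)‖ ≤ 𝓛⁻²⁰²²` through the pointwise lemmas of
`Section12ShiftedSmallCircle` (Lemma 5.8 — at (A)-exponent 15 in `RepairGapSection12ShiftedSmallCirclePremise`) and consumes (A) once more in the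
packaged evaluation `circ_omega1_eval_forAllLarge` through Lemma 5.7 (`Lemma57.lemma_5_7`, `|L′(1,χ)| ≥ e⁻¹/4`), which needs only
`‖L(1,χ)‖ ≤ c/log D` (`Repair.Gap.lemma57_of_norm_le`, bed-2 g4 p562983). The five (A)-threading theorems are re-run VERBATIM with
`hA : ‖L(1,χ)‖ ≤ 𝓛⁻¹⁵`, the small-circle twins at 15 and the 5.7 door re-pointed (threshold `log D ≥ 1/c₅₇` added, as in g6's
`logfree_mid_bound_pow15`): `norm_true_on_shifted_sphere_le_pow15`, `norm_circ_omega1_true_sub_main_kernel1_pow15`,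
`norm_circ_omega1_pair_sub_main_pow15`, **`circ_omega1_eval_forAllLarge_pow15`**, **`circ_omega1_pair_eval_forAllLarge_pow15`** (guard
`‖L(1,χ)‖ ≤ 𝓛⁻¹⁵`, same constants; the docstrings below are the tree's, read with `𝓛⁻²⁰²²` ↦ `𝓛⁻¹⁵`). Input of the u025 assembly (leaf h1212
`Typed.Sec12C.Eq1212`) and of u030 at (A)-exponent 15. Theorems only; no definition, no named fact; nothing about (A) itself.

## References

* Y. Zhang, arXiv:2211.02515v1 (2022), §12 proofs of Lemmas 12.2–12.3, pp. 69–70 (tex L3528–L3586); §5 Lemmas 5.7, 5.8; §4 (4.1).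
  [cite: Zhang2022LandauSiegel, §12 Lemmas 12.2–12.3]
* H. L. Montgomery, R. C. Vaughan, *Multiplicative Number Theory I*, CUP 2007, §6.2. [cite: MontgomeryVaughan2007, §6.2]
-/

noncomputable section

open Complex Real Set Finset Metric

namespace Literature.NumberTheory.LFunctions.Zhang2022.Lemma84

open Skeleton GaussWeight

section ShiftedCircleOmegaPow15

variable {D : ℕ}

/-- `Π̂ = ∏_{q∣n}(1 − q⁻¹)⁻¹ ≥ 1`. [cite: Zhang2022LandauSiegel, §8 Lemma 8.3] -/
private theorem one_le_hatPi'_o15 (n : ℕ) : 1 ≤ ∏ q ∈ n.primeFactors, (1 - (q : ℝ)⁻¹)⁻¹ := by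
  refine le_of_eq_of_le (Finset.prod_const_one (s := n.primeFactors)).symm
    (Finset.prod_le_prod (fun _ _ => zero_le_one) fun q hq => ?_)
  have hq2 : (2 : ℝ) ≤ q := by exact_mod_cast (Nat.prime_of_mem_primeFactors hq).two_le
  have h1 : 0 < 1 - (q : ℝ)⁻¹ := by
    have : (q : ℝ)⁻¹ ≤ 1 / 2 := by rw [inv_eq_one_div]; gcongr
    linarith
  have h2 : 1 - (q : ℝ)⁻¹ ≤ 1 := by
    have : 0 ≤ (q : ℝ)⁻¹ := by positivity
    linarith
  exact (one_le_inv₀ h1).mpr h2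

/-- A threshold `D₀` beyond which `log D ≥ M`. [folklore] -/
private theorem exists_nat_le_log'_o15 (M : ℝ) : ∃ D₀ : ℕ, ∀ D : ℕ, D₀ ≤ D → M ≤ Real.log D := by
  refine ⟨⌈Real.exp M⌉₊ + 1, fun D hD => ?_⟩
  have h1 : Real.exp M ≤ D := by
    have : (⌈Real.exp M⌉₊ : ℝ) + 1 ≤ D := by exact_mod_cast hD
    linarith [Nat.le_ceil (Real.exp M)]
  have hD0 : (0 : ℝ) < D := lt_of_lt_of_le (Real.exp_pos M) h1
  rw [Real.le_log_iff_exp_le hD0]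
  exact h1
/-- **H-b: the sup of the TRUE quotient on the circle `|z − (β₆ − w)| = 3α`.** Under the hypotheses of
`Lemma84.norm_quot_sub_model_on_shifted_sphere` (`χ` primitive, `𝓛 ≥ 3`, (A), `K ≥ 7 + 15|c′|`, `Kπ ≤ 𝓛⁸`,
`0 < ℓ₀ ≤ |L′(1,χ)|`, `(1+16e^{9/2}π²K²)𝓛⁻¹⁵ ≤ ℓ₀α/4`, `‖𝔲(u) − Π(d,r)‖ ≤ C₈₃𝓛⁻⁸Π̂` on `|u − 1| ≤ 5α`) and
`|w| = α`: for every `z` on the circle, with `u = 1 − β₆ + w + z`,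
`‖𝔲(u)L(u+β_{j+1})L(u+β_{j+2})/L(u)‖ ≤ ((1+16e^{9/2}π²K²)(24K²+2K) + 128e^{9/2}πK³C₈₃ + 2e^{9/2}K²π)·Π̂²`
(comparison `Δ ≤ (…)Π̂²𝓛⁻¹⁵ ≤ (…)Π̂²` plus the model size `Π̂²·2e^{9/2}(1+𝓛)𝓛K²α/3 ≤ 2e^{9/2}K²π·Π̂²`, as
`(1+𝓛)𝓛α = (1+𝓛)π𝓛⁻⁸ ≤ 3π`... precisely `≤ π` for `𝓛 ≥ 3`). This is the `M` of the `ω₁`-removal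
`ShiftedContour.norm_circ_omega1_sub_le`. [cite: Zhang2022LandauSiegel, §12 proof of Lemma 12.2, p. 69; §5 Lemma 5.8] -/
theorem norm_true_on_shifted_sphere_le_pow15 [NeZero D] (χ : DirichletCharacter ℂ D) (c' : ℝ)
    (hprim : χ.IsPrimitive) (h𝓛 : 3 ≤ Real.log D)
    (hA : ‖χ.LFunction 1‖ ≤ 1 / Real.log D ^ 15) (j : ℕ) {d r : ℕ} (hd : d ≠ 0) (hr : r ≠ 0)
    (U : ℂ → ℂ) {C₈₃ K ℓ₀ : ℝ} (hC₈₃ : 0 ≤ C₈₃) (hK : 7 + 15 * |c'| ≤ K)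
    (hKL : K * π ≤ Real.log D ^ 8) (hℓ₀ : 0 < ℓ₀) (hℓ : ℓ₀ ≤ ‖deriv χ.LFunction 1‖)
    (hE : (1 + 16 * Real.exp (9 / 2) * π ^ 2 * K ^ 2) / Real.log D ^ 15 ≤ ℓ₀ * alpha D / 4)
    (hU3 : ∀ s : ℂ, ‖s - 1‖ ≤ 5 * alpha D → ‖U s - PiW χ d r‖ ≤
      C₈₃ * (ell D ^ 8)⁻¹ * ∏ q ∈ (d * r).primeFactors, (1 - (q : ℝ)⁻¹)⁻¹)
    {w : ℂ} (hw : ‖w‖ = alpha D) {z : ℂ} (hz : z ∈ sphere (beta6 D - w) (3 * alpha D)) :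
    ‖U (1 - beta6 D + w + z) * χ.LFunction (1 - beta6 D + w + z + betaJ c' D (j + 1)) *
        χ.LFunction (1 - beta6 D + w + z + betaJ c' D (j + 2)) / χ.LFunction (1 - beta6 D + w + z)‖ ≤
      ((1 + 16 * Real.exp (9 / 2) * π ^ 2 * K ^ 2) * (24 * K ^ 2 + 2 * K) +
          128 * Real.exp (9 / 2) * π * K ^ 3 * C₈₃ + 2 * Real.exp (9 / 2) * K ^ 2 * π) *
        (∏ q ∈ (d * r).primeFactors, (1 - (q : ℝ)⁻¹)⁻¹) ^ 2 := by
  set hatPi : ℝ := ∏ q ∈ (d * r).primeFactors, (1 - (q : ℝ)⁻¹)⁻¹ with hhatPi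
  set L : ℝ := Real.log D with hLdef
  have hℓ1 : 1 ≤ ell D := by rw [ell]; linarith
  have hL1 : 1 ≤ L := by linarith
  have hL0 : 0 < L := by linarith
  have hα : 0 < alpha D := alpha_pos' (by linarith)
  have hK0 : 0 ≤ K := by linarith [abs_nonneg c']
  have hP1 : 1 ≤ hatPi := one_le_hatPi'_o15 (d * r)
  have hP2 : 0 ≤ hatPi ^ 2 := by positivity
  -- comparison with the model, `Δ ≤ (…)·Π̂²/𝓛¹⁵`
  have hΔ := (norm_quot_sub_model_on_shifted_sphere_pow15 χ c' hprim h𝓛 hA j hd hr U hC₈₃ hK hKL hℓ₀ hℓ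
      hE hU3 hw hz).trans (delta_le (by linarith : 1 ≤ Real.log D) hK0 hC₈₃ (d * r))
  -- the model size
  have hM := norm_model_on_shifted_sphere_le χ c' hprim h𝓛 j hd hr hK hw hz
  -- `(…)/𝓛¹⁵ ≤ (…)` and `(1+𝓛)𝓛·K²α/3 ≤ K²π` (`α = π/𝓛⁹`)
  have hαeq : alpha D = π / L ^ 9 := alpha_eq D
  have h15 : ((1 + 16 * Real.exp (9 / 2) * π ^ 2 * K ^ 2) * (24 * K ^ 2 + 2 * K) +
        128 * Real.exp (9 / 2) * π * K ^ 3 * C₈₃) * hatPi ^ 2 / L ^ 15 ≤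
      ((1 + 16 * Real.exp (9 / 2) * π ^ 2 * K ^ 2) * (24 * K ^ 2 + 2 * K) +
        128 * Real.exp (9 / 2) * π * K ^ 3 * C₈₃) * hatPi ^ 2 := by
    refine div_le_self (by positivity) (one_le_pow₀ hL1)
  have hmod : hatPi ^ 2 * (2 * Real.exp (9 / 2) * (1 + L) * L) * (K ^ 2 * alpha D / 3) ≤
      2 * Real.exp (9 / 2) * K ^ 2 * π * hatPi ^ 2 := by
    rw [hαeq]
    have hkey : (1 + L) * L * (π / L ^ 9) / 3 ≤ π := by
      rw [div_le_iff₀ (by norm_num : (0 : ℝ) < 3)]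
      have hL9 : (1 + L) * L ≤ 3 * L ^ 9 := by
        have h2 : (1 + L) * L ≤ 2 * L ^ 2 := by nlinarith
        have h3 : L ^ 2 ≤ L ^ 9 := pow_le_pow_right₀ hL1 (by norm_num)
        nlinarith
      calc (1 + L) * L * (π / L ^ 9) = ((1 + L) * L / L ^ 9) * π := by ring
        _ ≤ 3 * π := by
            refine mul_le_mul_of_nonneg_right ?_ Real.pi_pos.le
            rw [div_le_iff₀ (by positivity)]
            exact hL9
        _ = π * 3 := by ring
    have e : hatPi ^ 2 * (2 * Real.exp (9 / 2) * (1 + L) * L) * (K ^ 2 * (π / L ^ 9) / 3) =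
        2 * Real.exp (9 / 2) * K ^ 2 * hatPi ^ 2 * ((1 + L) * L * (π / L ^ 9) / 3) := by ring
    rw [e]
    calc 2 * Real.exp (9 / 2) * K ^ 2 * hatPi ^ 2 * ((1 + L) * L * (π / L ^ 9) / 3)
        ≤ 2 * Real.exp (9 / 2) * K ^ 2 * hatPi ^ 2 * π :=
          mul_le_mul_of_nonneg_left hkey (by positivity)
      _ = 2 * Real.exp (9 / 2) * K ^ 2 * π * hatPi ^ 2 := by ring
  -- triangle inequality
  have htri := norm_le_norm_add_norm_sub'
    (U (1 - beta6 D + w + z) * χ.LFunction (1 - beta6 D + w + z + betaJ c' D (j + 1)) *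
        χ.LFunction (1 - beta6 D + w + z + betaJ c' D (j + 2)) / χ.LFunction (1 - beta6 D + w + z))
    (PiW χ d r * deriv χ.LFunction 1 * (z + w - beta6 D + betaJ c' D (j + 1)) *
        (z + w - beta6 D + betaJ c' D (j + 2)) / (z + w - beta6 D))
  have hsum : ‖PiW χ d r * deriv χ.LFunction 1 * (z + w - beta6 D + betaJ c' D (j + 1)) *
          (z + w - beta6 D + betaJ c' D (j + 2)) / (z + w - beta6 D)‖ +
        ‖U (1 - beta6 D + w + z) * χ.LFunction (1 - beta6 D + w + z + betaJ c' D (j + 1)) *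
            χ.LFunction (1 - beta6 D + w + z + betaJ c' D (j + 2)) /
            χ.LFunction (1 - beta6 D + w + z) -
          PiW χ d r * deriv χ.LFunction 1 * (z + w - beta6 D + betaJ c' D (j + 1)) *
            (z + w - beta6 D + betaJ c' D (j + 2)) / (z + w - beta6 D)‖ ≤
      2 * Real.exp (9 / 2) * K ^ 2 * π * hatPi ^ 2 +
        ((1 + 16 * Real.exp (9 / 2) * π ^ 2 * K ^ 2) * (24 * K ^ 2 + 2 * K) +
          128 * Real.exp (9 / 2) * π * K ^ 3 * C₈₃) * hatPi ^ 2 :=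
    add_le_add (hM.trans hmod) (hΔ.trans h15)
  refine (htri.trans hsum).trans (le_of_eq ?_)
  ring

/-- **The small circle WITH `ω₁`, kernel `Y^zω₁(z)/z`, in one call** (`Z22:§12.u030`; the circle term of
`ShiftedContour.norm_vline_sub_circ_le` at `c = β₆ − w`, `R = 3α`, evaluated). For `χ` primitive, `χ ≠ χ₀`,
`𝓛 = log D ≥ 3`, (A) `‖L(1,χ)‖ ≤ 𝓛⁻²⁰²²`, `α < 1/30`, `K ≥ 7 + 15|c′|` with `Kπ ≤ 𝓛⁸`, `0 < ℓ₀ ≤ |L′(1,χ)|`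
with `(1+16e^{9/2}π²K²)𝓛⁻¹⁵ ≤ ℓ₀α/4`, `𝔲` holomorphic on `σ > 9/10` with `‖𝔲(u) − Π(d,r)‖ ≤ C₈₃𝓛⁻⁸Π̂` on
`|u−1| ≤ 5α` (Lemma 8.3 (i), (iii′)), `|w| = α`, `1 ≤ Y ≤ P` and `Λ ≥ 1` (the lane's `Λ = 𝓛³⁰`):
`‖(2πi)⁻¹∮_{C(β₆−w,3α)} 𝔲(u)L(u+β_{j+1})L(u+β_{j+2})/L(u)·Y^{z+0}ω₁(z+0)/(z+0) dz
   − Π(d,r)L′(1,χ)·(w − β₆ + β_{j+1} + β_{j+2} + β_{j+1}β_{j+2}(Y^{β₆−w} − 1)/(β₆−w))‖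
 ≤ (6e^{11π/2}·Δ₀ + (363/4)e^{11π/2}π²·M₀)·Π̂²·𝓛⁻¹⁵`, `Δ₀ = (1+16e^{9/2}π²K²)(24K²+2K) + 128e^{9/2}πK³C₈₃`,
`M₀ = Δ₀ + 2e^{9/2}K²π` (`u = 1 − β₆ + w + z`): `ω₁`-removal (`ShiftedContour.norm_circ_omega1_sub_le`, glue
`(363/4)e^{11π/2}M₀Π̂²α² ≤ (363/4)e^{11π/2}π²M₀Π̂²𝓛⁻¹⁵`) + `Lemma84.norm_circ_true_sub_main_kernel1`. The value
subtracted is `Π L′(1,χ)·circ030` (`Typed.Sec12B.U031_holds`).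
[cite: Zhang2022LandauSiegel, §12 proof of Lemma 12.3, p. 70, tex L3564–L3577] [cite: Zhang2022LandauSiegel, §4 (4.1)] -/
theorem norm_circ_omega1_true_sub_main_kernel1_pow15 [NeZero D] (χ : DirichletCharacter ℂ D) (c' : ℝ)
    (hprim : χ.IsPrimitive) (hχ : χ ≠ 1) (h𝓛 : 3 ≤ Real.log D)
    (hA : ‖χ.LFunction 1‖ ≤ 1 / Real.log D ^ 15) (hα30 : alpha D < 1 / 30)
    (j : ℕ) {d r : ℕ} (hd : d ≠ 0) (hr : r ≠ 0)
    (U : ℂ → ℂ) (hUd : DifferentiableOn ℂ U {s : ℂ | 9 / 10 < s.re})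
    {C₈₃ K ℓ₀ : ℝ} (hC₈₃ : 0 ≤ C₈₃) (hK : 7 + 15 * |c'| ≤ K)
    (hKL : K * π ≤ Real.log D ^ 8) (hℓ₀ : 0 < ℓ₀) (hℓ : ℓ₀ ≤ ‖deriv χ.LFunction 1‖)
    (hE : (1 + 16 * Real.exp (9 / 2) * π ^ 2 * K ^ 2) / Real.log D ^ 15 ≤ ℓ₀ * alpha D / 4)
    (hU3 : ∀ s : ℂ, ‖s - 1‖ ≤ 5 * alpha D → ‖U s - PiW χ d r‖ ≤
      C₈₃ * (ell D ^ 8)⁻¹ * ∏ q ∈ (d * r).primeFactors, (1 - (q : ℝ)⁻¹)⁻¹)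
    {w : ℂ} (hw : ‖w‖ = alpha D) {Y : ℝ} (hY : 1 ≤ Y) (hYP : Y ≤ bigP D) {Λ : ℝ} (hΛ : 1 ≤ Λ) :
    ‖(2 * π * I)⁻¹ * (∮ z in C(beta6 D - w, 3 * alpha D),
          U (1 - beta6 D + w + z) * χ.LFunction (1 - beta6 D + w + z + betaJ c' D (j + 1)) *
              χ.LFunction (1 - beta6 D + w + z + betaJ c' D (j + 2)) /
              χ.LFunction (1 - beta6 D + w + z) *
            (((Y : ℝ) : ℂ) ^ (z + 0) * omega1 Λ (z + 0) / (z + 0))) -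
        PiW χ d r * deriv χ.LFunction 1 *
          (w - beta6 D + betaJ c' D (j + 1) + betaJ c' D (j + 2) +
            betaJ c' D (j + 1) * betaJ c' D (j + 2) *
              ((((Y : ℝ) : ℂ) ^ (beta6 D - w) - 1) / (beta6 D - w)))‖ ≤
      (6 * Real.exp (11 * π / 2) *
            ((1 + 16 * Real.exp (9 / 2) * π ^ 2 * K ^ 2) * (24 * K ^ 2 + 2 * K) +
              128 * Real.exp (9 / 2) * π * K ^ 3 * C₈₃) +
          363 / 4 * Real.exp (11 * π / 2) * π ^ 2 *
            ((1 + 16 * Real.exp (9 / 2) * π ^ 2 * K ^ 2) * (24 * K ^ 2 + 2 * K) +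
              128 * Real.exp (9 / 2) * π * K ^ 3 * C₈₃ + 2 * Real.exp (9 / 2) * K ^ 2 * π)) *
        (∏ q ∈ (d * r).primeFactors, (1 - (q : ℝ)⁻¹)⁻¹) ^ 2 / Real.log D ^ 15 := by
  set hatPi : ℝ := ∏ q ∈ (d * r).primeFactors, (1 - (q : ℝ)⁻¹)⁻¹ with hhatPi
  set L : ℝ := Real.log D with hLdef
  set Δ₀ : ℝ := (1 + 16 * Real.exp (9 / 2) * π ^ 2 * K ^ 2) * (24 * K ^ 2 + 2 * K) +
      128 * Real.exp (9 / 2) * π * K ^ 3 * C₈₃ with hΔ₀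
  set M₀ : ℝ := (1 + 16 * Real.exp (9 / 2) * π ^ 2 * K ^ 2) * (24 * K ^ 2 + 2 * K) +
      128 * Real.exp (9 / 2) * π * K ^ 3 * C₈₃ + 2 * Real.exp (9 / 2) * K ^ 2 * π with hM₀
  -- the true quotient as a function of `z`
  set Φ : ℂ → ℂ := fun z => U (1 - beta6 D + w + z) *
      χ.LFunction (1 - beta6 D + w + z + betaJ c' D (j + 1)) *
      χ.LFunction (1 - beta6 D + w + z + betaJ c' D (j + 2)) / χ.LFunction (1 - beta6 D + w + z)
    with hΦdef
  have hℓ1 : 1 ≤ ell D := by rw [ell]; linarith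
  have hL1 : 1 ≤ L := by linarith
  have hL0 : 0 < L := by linarith
  have hα : 0 < alpha D := alpha_pos' (by linarith)
  have hK0 : 0 ≤ K := by linarith [abs_nonneg c']
  have hK3 : 3 ≤ K := by linarith [abs_nonneg c']
  have hP1 : 1 ≤ hatPi := one_le_hatPi'_o15 (d * r)
  have hΔ₀0 : 0 ≤ Δ₀ := by positivity
  have hM₀0 : 0 ≤ M₀ := by positivity
  obtain ⟨hc0, hc52, hc3⟩ := center_shift_bounds hα hw
  -- data of the `ω₁`-removal lemma
  have hLnz : ∀ z ∈ sphere (beta6 D - w) (3 * alpha D), χ.LFunction (1 - beta6 D + w + z) ≠ 0 :=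
    fun z hz => (LFunction_ne_zero_on_shifted_sphere_pow15 χ hprim h𝓛 hA hK3 hKL hℓ₀ hℓ hE hw hz).2
  have hΦc : ContinuousOn Φ (sphere (beta6 D - w) (3 * alpha D)) :=
    continuousOn_true_on_shifted_sphere χ hχ c' j hα hα30 hw U hUd hLnz
  have hMb : ∀ z ∈ sphere (beta6 D - w) (3 * alpha D), ‖Φ z‖ ≤ M₀ * hatPi ^ 2 := fun z hz =>
    norm_true_on_shifted_sphere_le_pow15 χ c' hprim h𝓛 hA j hd hr U hC₈₃ hK hKL hℓ₀ hℓ hE hU3 hw hz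
  have hsmall : (‖beta6 D - w‖ + 3 * alpha D) ^ 2 ≤ 4 * Λ := by
    have h1 : ‖beta6 D - w‖ + 3 * alpha D ≤ 1 := by linarith
    have h2 : (‖beta6 D - w‖ + 3 * alpha D) ^ 2 ≤ 1 ^ 2 := pow_le_pow_left₀ (by positivity) h1 2
    linarith
  have hglue := ShiftedContour.norm_circ_omega1_sub_le (Y := Y) (by linarith : (0 : ℝ) < Λ) hY hc3
    hsmall hΦc hMb
  have hglue' := hglue.trans
    (omega1_glue_le hℓ1 hw hY hYP hΛ (by positivity : 0 ≤ M₀ * hatPi ^ 2))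
  -- the bare-kernel evaluation
  have hbare := norm_circ_true_sub_main_kernel1_pow15 χ c' hprim hχ h𝓛 hA hα30 j hd hr U hUd hC₈₃ hK hKL hℓ₀
    hℓ hE hU3 hw hY hYP
  -- triangle inequality
  have htri := norm_sub_le_norm_sub_add_norm_sub
    ((2 * π * I)⁻¹ * (∮ z in C(beta6 D - w, 3 * alpha D),
      Φ z * (((Y : ℝ) : ℂ) ^ (z + 0) * omega1 Λ (z + 0) / (z + 0))))
    ((2 * π * I)⁻¹ * (∮ z in C(beta6 D - w, 3 * alpha D), Φ z * (((Y : ℝ) : ℂ) ^ z / z)))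
    (PiW χ d r * deriv χ.LFunction 1 *
      (w - beta6 D + betaJ c' D (j + 1) + betaJ c' D (j + 2) +
        betaJ c' D (j + 1) * betaJ c' D (j + 2) *
          ((((Y : ℝ) : ℂ) ^ (beta6 D - w) - 1) / (beta6 D - w))))
  -- `α² ≤ π²/𝓛¹⁵`
  have hαeq : alpha D = π / L ^ 9 := alpha_eq D
  have hα2 : alpha D ^ 2 ≤ π ^ 2 / L ^ 15 := by
    rw [hαeq, div_pow]
    have h : L ^ 15 ≤ (L ^ 9) ^ 2 := by
      rw [← pow_mul]
      exact pow_le_pow_right₀ hL1 (by norm_num)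
    exact div_le_div_of_nonneg_left (by positivity) (by positivity) h
  have hglue'' : 363 / 4 * Real.exp (11 * π / 2) * (M₀ * hatPi ^ 2) * alpha D ^ 2 ≤
      363 / 4 * Real.exp (11 * π / 2) * π ^ 2 * M₀ * hatPi ^ 2 / L ^ 15 := by
    calc 363 / 4 * Real.exp (11 * π / 2) * (M₀ * hatPi ^ 2) * alpha D ^ 2
        ≤ 363 / 4 * Real.exp (11 * π / 2) * (M₀ * hatPi ^ 2) * (π ^ 2 / L ^ 15) :=
          mul_le_mul_of_nonneg_left hα2 (by positivity)
      _ = _ := by ring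
  have hbare' : ‖(2 * π * I)⁻¹ * (∮ z in C(beta6 D - w, 3 * alpha D), Φ z * (((Y : ℝ) : ℂ) ^ z / z)) -
        PiW χ d r * deriv χ.LFunction 1 *
          (w - beta6 D + betaJ c' D (j + 1) + betaJ c' D (j + 2) +
            betaJ c' D (j + 1) * betaJ c' D (j + 2) *
              ((((Y : ℝ) : ℂ) ^ (beta6 D - w) - 1) / (beta6 D - w)))‖ ≤
      6 * Real.exp (11 * π / 2) * (Δ₀ * hatPi ^ 2 / L ^ 15) := hbare
  have hfin : 363 / 4 * Real.exp (11 * π / 2) * π ^ 2 * M₀ * hatPi ^ 2 / L ^ 15 +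
        6 * Real.exp (11 * π / 2) * (Δ₀ * hatPi ^ 2 / L ^ 15) =
      (6 * Real.exp (11 * π / 2) * Δ₀ + 363 / 4 * Real.exp (11 * π / 2) * π ^ 2 * M₀) *
        hatPi ^ 2 / L ^ 15 := by ring
  rw [← hfin]
  exact htri.trans (add_le_add (hglue'.trans hglue'') hbare')

/-- **The small circle WITH `ω₁`, u025 form (pair of lengths `Y₂`, `Y₁`)**: under the same hypotheses with
`1 ≤ Y₁, Y₂ ≤ P`, the DIFFERENCE of the two `ω₁`-circle integrals is
`Π(d,r)L′(1,χ)·β_{j+1}β_{j+2}(Y₂^{β₆−w} − Y₁^{β₆−w})/(β₆−w)` up to twice the error of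
`norm_circ_omega1_true_sub_main_kernel1_pow15` — the value is `Π L′(1,χ)·circ025` (`Typed.Sec12B.circ025_eq`), and the
two circle terms are LITERALLY those of `ShiftedContour.norm_vline_sub_circ_le` at `Y = P″₂/dr`, `P″₁/dr`,
whose line integrals differ by `lineInt024` (`Z22:§12.u025`, p. 69, tex L3534).
[cite: Zhang2022LandauSiegel, §12 proof of Lemma 12.2, p. 69, tex L3534] [cite: Zhang2022LandauSiegel, §4 (4.1)] -/
theorem norm_circ_omega1_pair_sub_main_pow15 [NeZero D] (χ : DirichletCharacter ℂ D) (c' : ℝ)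
    (hprim : χ.IsPrimitive) (hχ : χ ≠ 1) (h𝓛 : 3 ≤ Real.log D)
    (hA : ‖χ.LFunction 1‖ ≤ 1 / Real.log D ^ 15) (hα30 : alpha D < 1 / 30)
    (j : ℕ) {d r : ℕ} (hd : d ≠ 0) (hr : r ≠ 0)
    (U : ℂ → ℂ) (hUd : DifferentiableOn ℂ U {s : ℂ | 9 / 10 < s.re})
    {C₈₃ K ℓ₀ : ℝ} (hC₈₃ : 0 ≤ C₈₃) (hK : 7 + 15 * |c'| ≤ K)
    (hKL : K * π ≤ Real.log D ^ 8) (hℓ₀ : 0 < ℓ₀) (hℓ : ℓ₀ ≤ ‖deriv χ.LFunction 1‖)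
    (hE : (1 + 16 * Real.exp (9 / 2) * π ^ 2 * K ^ 2) / Real.log D ^ 15 ≤ ℓ₀ * alpha D / 4)
    (hU3 : ∀ s : ℂ, ‖s - 1‖ ≤ 5 * alpha D → ‖U s - PiW χ d r‖ ≤
      C₈₃ * (ell D ^ 8)⁻¹ * ∏ q ∈ (d * r).primeFactors, (1 - (q : ℝ)⁻¹)⁻¹)
    {w : ℂ} (hw : ‖w‖ = alpha D) {Y₁ Y₂ : ℝ} (hY₁ : 1 ≤ Y₁) (hY₁P : Y₁ ≤ bigP D)
    (hY₂ : 1 ≤ Y₂) (hY₂P : Y₂ ≤ bigP D) {Λ : ℝ} (hΛ : 1 ≤ Λ) :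
    ‖((2 * π * I)⁻¹ * (∮ z in C(beta6 D - w, 3 * alpha D),
          U (1 - beta6 D + w + z) * χ.LFunction (1 - beta6 D + w + z + betaJ c' D (j + 1)) *
              χ.LFunction (1 - beta6 D + w + z + betaJ c' D (j + 2)) /
              χ.LFunction (1 - beta6 D + w + z) *
            (((Y₂ : ℝ) : ℂ) ^ (z + 0) * omega1 Λ (z + 0) / (z + 0))) -
        (2 * π * I)⁻¹ * (∮ z in C(beta6 D - w, 3 * alpha D),
          U (1 - beta6 D + w + z) * χ.LFunction (1 - beta6 D + w + z + betaJ c' D (j + 1)) *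
              χ.LFunction (1 - beta6 D + w + z + betaJ c' D (j + 2)) /
              χ.LFunction (1 - beta6 D + w + z) *
            (((Y₁ : ℝ) : ℂ) ^ (z + 0) * omega1 Λ (z + 0) / (z + 0)))) -
        PiW χ d r * deriv χ.LFunction 1 *
          (betaJ c' D (j + 1) * betaJ c' D (j + 2) *
            ((((Y₂ : ℝ) : ℂ) ^ (beta6 D - w) - ((Y₁ : ℝ) : ℂ) ^ (beta6 D - w)) / (beta6 D - w)))‖ ≤
      2 * ((6 * Real.exp (11 * π / 2) *
            ((1 + 16 * Real.exp (9 / 2) * π ^ 2 * K ^ 2) * (24 * K ^ 2 + 2 * K) +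
              128 * Real.exp (9 / 2) * π * K ^ 3 * C₈₃) +
          363 / 4 * Real.exp (11 * π / 2) * π ^ 2 *
            ((1 + 16 * Real.exp (9 / 2) * π ^ 2 * K ^ 2) * (24 * K ^ 2 + 2 * K) +
              128 * Real.exp (9 / 2) * π * K ^ 3 * C₈₃ + 2 * Real.exp (9 / 2) * K ^ 2 * π)) *
        (∏ q ∈ (d * r).primeFactors, (1 - (q : ℝ)⁻¹)⁻¹) ^ 2 / Real.log D ^ 15) := by
  have h₂ := norm_circ_omega1_true_sub_main_kernel1_pow15 χ c' hprim hχ h𝓛 hA hα30 j hd hr U hUd hC₈₃ hK hKL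
    hℓ₀ hℓ hE hU3 hw hY₂ hY₂P hΛ
  have h₁ := norm_circ_omega1_true_sub_main_kernel1_pow15 χ c' hprim hχ h𝓛 hA hα30 j hd hr U hUd hC₈₃ hK hKL
    hℓ₀ hℓ hE hU3 hw hY₁ hY₁P hΛ
  -- abbreviate the three values
  set A₂ := (2 * π * I)⁻¹ * (∮ z in C(beta6 D - w, 3 * alpha D),
      U (1 - beta6 D + w + z) * χ.LFunction (1 - beta6 D + w + z + betaJ c' D (j + 1)) *
          χ.LFunction (1 - beta6 D + w + z + betaJ c' D (j + 2)) / χ.LFunction (1 - beta6 D + w + z) *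
        (((Y₂ : ℝ) : ℂ) ^ (z + 0) * omega1 Λ (z + 0) / (z + 0))) with hA₂
  set A₁ := (2 * π * I)⁻¹ * (∮ z in C(beta6 D - w, 3 * alpha D),
      U (1 - beta6 D + w + z) * χ.LFunction (1 - beta6 D + w + z + betaJ c' D (j + 1)) *
          χ.LFunction (1 - beta6 D + w + z + betaJ c' D (j + 2)) / χ.LFunction (1 - beta6 D + w + z) *
        (((Y₁ : ℝ) : ℂ) ^ (z + 0) * omega1 Λ (z + 0) / (z + 0))) with hA₁
  set ellPi : ℂ := PiW χ d r * deriv χ.LFunction 1 with hellPi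
  set βa : ℂ := betaJ c' D (j + 1) with hβa
  set βb : ℂ := betaJ c' D (j + 2) with hβb
  set M₂ : ℂ := ellPi * (w - beta6 D + βa + βb + βa * βb * ((((Y₂ : ℝ) : ℂ) ^ (beta6 D - w) - 1) /
      (beta6 D - w))) with hM₂
  set M₁ : ℂ := ellPi * (w - beta6 D + βa + βb + βa * βb * ((((Y₁ : ℝ) : ℂ) ^ (beta6 D - w) - 1) /
      (beta6 D - w))) with hM₁
  have e : A₂ - A₁ - ellPi * (βa * βb * ((((Y₂ : ℝ) : ℂ) ^ (beta6 D - w) -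
      ((Y₁ : ℝ) : ℂ) ^ (beta6 D - w)) / (beta6 D - w))) = (A₂ - M₂) - (A₁ - M₁) := by
    rw [hM₂, hM₁]
    ring
  rw [e]
  refine (norm_sub_le _ _).trans ?_
  linarith [h₂, h₁]

/-- **The `ω₁`-circle evaluation, packaged** (kernel `Y^zω₁(z)/z`; `Z22:§12.u030` and, twice, `u025`): for
every `c′` and every real `C₈₃` there are `C ≥ 0` and `D₀` such that for `D ≥ D₀`, `χ` real primitive mod `D`
with (A), every `j`, `d, r ≥ 1`, every `𝔲` holomorphic on `σ > 9/10` with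
`‖𝔲(u) − Π(d,r)‖ ≤ C₈₃𝓛⁻⁸Π̂` on `|u − 1| ≤ 5α` (the clauses (i), (iii′) of `Skeleton.Lemma83Rel`, a theorem of the
tree), every `|w| = α`, `1 ≤ Y ≤ P` and `Λ ≥ 1`:
`‖(2πi)⁻¹∮_{C(β₆−w,3α)} 𝔲(u)L(u+β_{j+1})L(u+β_{j+2})/L(u)·Y^{z+0}ω₁ Λ (z+0)/(z+0) dz
   − Π(d,r)L′(1,χ)·(w − β₆ + β_{j+1} + β_{j+2} + β_{j+1}β_{j+2}(Y^{β₆−w} − 1)/(β₆−w))‖ ≤ C·𝓛⁻¹⁵·Π̂²`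
— `norm_circ_omega1_true_sub_main_kernel1_pow15` with `K = 7 + 15|c′|`, `ℓ₀ = e⁻¹/4 ≤ |L′(1,χ)|` (Lemma 5.7,
`Lemma57.lemma_5_7`), `Kπ ≤ 𝓛 ≤ 𝓛⁸`, `4(1+16e^{9/2}π²K²)/(ℓ₀π) ≤ 𝓛`, `α = π𝓛⁻⁹ < 1/30`, `𝓛 ≥ 3`, and `C₈₃`
replaced by `|C₈₃|`. [cite: Zhang2022LandauSiegel, §12 proof of Lemma 12.3, p. 70, tex L3564] [cite: Zhang2022LandauSiegel, §5 Lemma 5.7] -/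
theorem circ_omega1_eval_forAllLarge_pow15 (c' C₈₃ : ℝ) :
    ∃ C : ℝ, 0 ≤ C ∧ ForAllLarge fun D _ χ => ‖χ.LFunction 1‖ ≤ 1 / Real.log D ^ 15 →
      ∀ j : ℕ, ∀ d r : ℕ, d ≠ 0 → r ≠ 0 → ∀ U : ℂ → ℂ,
        DifferentiableOn ℂ U {s : ℂ | 9 / 10 < s.re} →
        (∀ s : ℂ, ‖s - 1‖ ≤ 5 * alpha D → ‖U s - PiW χ d r‖ ≤
            C₈₃ * (ell D ^ 8)⁻¹ * ∏ q ∈ (d * r).primeFactors, (1 - (q : ℝ)⁻¹)⁻¹) →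
        ∀ w : ℂ, ‖w‖ = alpha D → ∀ Y : ℝ, 1 ≤ Y → Y ≤ bigP D → ∀ Λ : ℝ, 1 ≤ Λ →
          ‖(2 * π * I)⁻¹ * (∮ z in C(beta6 D - w, 3 * alpha D),
                U (1 - beta6 D + w + z) * χ.LFunction (1 - beta6 D + w + z + betaJ c' D (j + 1)) *
                    χ.LFunction (1 - beta6 D + w + z + betaJ c' D (j + 2)) /
                    χ.LFunction (1 - beta6 D + w + z) *
                  (((Y : ℝ) : ℂ) ^ (z + 0) * omega1 Λ (z + 0) / (z + 0))) -
              PiW χ d r * deriv χ.LFunction 1 *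
                (w - beta6 D + betaJ c' D (j + 1) + betaJ c' D (j + 2) +
                  betaJ c' D (j + 1) * betaJ c' D (j + 2) *
                    ((((Y : ℝ) : ℂ) ^ (beta6 D - w) - 1) / (beta6 D - w)))‖ ≤
            C * (ell D ^ 15)⁻¹ * (∏ q ∈ (d * r).primeFactors, (1 - (q : ℝ)⁻¹)⁻¹) ^ 2 := by
  obtain ⟨L₅₇, c57, hc57, h57⟩ := Repair.Gap.lemma57_of_norm_le
  set Cabs : ℝ := |C₈₃| with hCabs
  have hCabs0 : 0 ≤ Cabs := abs_nonneg _
  set K : ℝ := 7 + 15 * |c'| with hKdef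
  have hK0 : 0 ≤ K := by rw [hKdef]; positivity
  set C₅ : ℝ := 1 + 16 * Real.exp (9 / 2) * π ^ 2 * K ^ 2 with hC₅
  set ℓ₀ : ℝ := Real.exp (-1) / 4 with hℓ₀
  have hℓ₀0 : 0 < ℓ₀ := by positivity
  set Cfin : ℝ := 6 * Real.exp (11 * π / 2) * (C₅ * (24 * K ^ 2 + 2 * K) +
        128 * Real.exp (9 / 2) * π * K ^ 3 * Cabs) +
      363 / 4 * Real.exp (11 * π / 2) * π ^ 2 * (C₅ * (24 * K ^ 2 + 2 * K) +
        128 * Real.exp (9 / 2) * π * K ^ 3 * Cabs + 2 * Real.exp (9 / 2) * K ^ 2 * π) with hCfin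
  refine ⟨Cfin, by positivity, ?_⟩
  set Lmax : ℝ := max (max 3 L₅₇) (max (K * π) (4 * C₅ / (ℓ₀ * π))) with hLmax
  obtain ⟨D₂, hD₂⟩ := exists_nat_le_log'_o15 (max Lmax (max 1 (1 / c57)))
  refine ⟨D₂, fun D _ χ hD hq hp hA j d r hd hr U hUd hU3 w hw Y hY hYP Λ hΛ => ?_⟩
  have hLm0 := hD₂ D hD
  have hLm : Lmax ≤ Real.log D := le_trans (le_max_left _ _) hLm0
  have hLc57 : 1 / c57 ≤ Real.log D := le_trans (le_trans (le_max_right _ _) (le_max_right _ _)) hLm0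
  set 𝓛 : ℝ := Real.log D with h𝓛def
  have h𝓛3 : 3 ≤ 𝓛 := le_trans (by simp [hLmax]) hLm
  have hL57 : L₅₇ ≤ 𝓛 := le_trans (by simp [hLmax]) hLm
  have hLKπ : K * π ≤ 𝓛 := le_trans (by simp [hLmax]) hLm
  have hLC₅ : 4 * C₅ / (ℓ₀ * π) ≤ 𝓛 := le_trans (by simp [hLmax]) hLm
  have h𝓛1 : 1 ≤ 𝓛 := by linarith
  have hπ0 := Real.pi_pos
  -- `D ≥ 2`, `χ ≠ 1`
  have hD0 : (0 : ℝ) < D := by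
    rcases lt_or_ge 0 (D : ℝ) with h | h
    · exact h
    · have : Real.log (D : ℝ) ≤ 0 := by
        have : (D : ℝ) = 0 := le_antisymm h (Nat.cast_nonneg D)
        rw [this, Real.log_zero]
      linarith
  have hD3 : (3 : ℝ) ≤ D := by
    have hDexp : (D : ℝ) = Real.exp 𝓛 := by rw [h𝓛def, Real.exp_log hD0]
    have : Real.exp 3 ≤ Real.exp 𝓛 := Real.exp_le_exp.2 h𝓛3
    have h3 : (3 : ℝ) ≤ Real.exp 3 := by have := Real.add_one_le_exp (3 : ℝ); linarith
    linarith
  have hD2 : 2 ≤ D := by exact_mod_cast (show (2 : ℝ) ≤ D by linarith)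
  have hχ1 : χ ≠ 1 := Lemma31.ne_one_of_isPrimitive χ hD2 hp
  have hA' : ‖χ.LFunction 1‖ ≤ 1 / Real.log D ^ 15 := hA
  -- the Lemma 5.7 door: `𝓛⁻¹⁵ ≤ c₅₇/𝓛` since `𝓛¹⁴ ≥ 𝓛 ≥ 1/c₅₇`
  have hc57L : ‖χ.LFunction 1‖ ≤ c57 / Real.log D := by
    refine hA'.trans ?_
    have h𝓛0 : 0 < 𝓛 := by linarith
    rw [← h𝓛def, div_le_div_iff₀ (pow_pos h𝓛0 _) h𝓛0]
    have h14 : 𝓛 ≤ 𝓛 ^ 14 := le_self_pow₀ h𝓛1 (by norm_num)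
    have h1c : 1 ≤ c57 * 𝓛 ^ 14 := by
      have h := mul_le_mul_of_nonneg_left (hLc57.trans h14) hc57.le
      rwa [mul_one_div_cancel hc57.ne'] at h
    calc 1 * 𝓛 = 𝓛 := one_mul _
      _ ≤ (c57 * 𝓛 ^ 14) * 𝓛 := le_mul_of_one_le_left h𝓛0.le h1c
      _ = c57 * 𝓛 ^ 15 := by ring
  -- `α < 1/30`
  have hαeq : alpha D = π / 𝓛 ^ 9 := alpha_eq D
  have hα30 : alpha D < 1 / 30 := by
    rw [hαeq, div_lt_div_iff₀ (by positivity) (by norm_num)]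
    have h39 : (3 : ℝ) ^ 9 ≤ 𝓛 ^ 9 := pow_le_pow_left₀ (by norm_num) h𝓛3 9
    have hπ4 := Real.pi_lt_four
    nlinarith
  -- `|L′(1,χ)| ≥ ℓ₀`
  have hℓ : ℓ₀ ≤ ‖deriv χ.LFunction 1‖ := by
    have h := h57 D χ hp hq.sq_eq_one hL57 hc57L
    have hφpos : (0 : ℝ) < Nat.totient D := by exact_mod_cast Nat.totient_pos.mpr (by omega)
    have hφle : (Nat.totient D : ℝ) ≤ D := by exact_mod_cast Nat.totient_le D
    have hrat : (1 : ℝ) ≤ (D : ℝ) / Nat.totient D := by rw [le_div_iff₀ hφpos]; linarith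
    calc ℓ₀ = Real.exp (-1) / 4 * 1 := (mul_one _).symm
      _ ≤ Real.exp (-1) / 4 * ((D : ℝ) / Nat.totient D) := by gcongr
      _ ≤ (deriv χ.LFunction 1).re := h
      _ ≤ ‖deriv χ.LFunction 1‖ := Complex.re_le_norm _
  -- `Kπ ≤ 𝓛⁸` and the `E ≤ ℓ₀α/4` condition
  have hKL : K * π ≤ Real.log D ^ 8 := hLKπ.trans (le_self_pow₀ h𝓛1 (by norm_num))
  have hE : C₅ / Real.log D ^ 15 ≤ ℓ₀ * alpha D / 4 := by
    rw [hαeq, ← h𝓛def]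
    rw [div_le_iff₀ (by positivity)]
    have h1 : 4 * C₅ ≤ ℓ₀ * π * 𝓛 := by rw [div_le_iff₀ (by positivity)] at hLC₅; linarith
    have h2 : 𝓛 ^ 15 = 𝓛 ^ 9 * 𝓛 ^ 6 := by ring
    have h3 : 𝓛 ≤ 𝓛 ^ 6 := le_self_pow₀ h𝓛1 (by norm_num)
    have h4 : ℓ₀ * π * 𝓛 ≤ ℓ₀ * π * 𝓛 ^ 6 := mul_le_mul_of_nonneg_left h3 (by positivity)
    calc C₅ = 4 * C₅ / 4 := by ring
      _ ≤ ℓ₀ * π * 𝓛 ^ 6 / 4 := by linarith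
      _ = ℓ₀ * (π / 𝓛 ^ 9) / 4 * 𝓛 ^ 15 := by rw [h2]; field_simp
  -- Lemma 8.3 (iii′) with `|C₈₃|`
  have hU3' : ∀ s : ℂ, ‖s - 1‖ ≤ 5 * alpha D → ‖U s - PiW χ d r‖ ≤
      Cabs * (ell D ^ 8)⁻¹ * ∏ q ∈ (d * r).primeFactors, (1 - (q : ℝ)⁻¹)⁻¹ := by
    intro s hs
    refine (hU3 s hs).trans ?_
    have h1 := one_le_hatPi'_o15 (d * r)
    gcongr
    exact le_abs_self _
  have h := norm_circ_omega1_true_sub_main_kernel1_pow15 χ c' hp hχ1 h𝓛3 hA' hα30 j hd hr U hUd hCabs0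
    (le_refl K) hKL hℓ₀0 hℓ hE hU3' hw hY hYP hΛ
  refine h.trans (le_of_eq ?_)
  rw [hCfin, hC₅, ell, ← h𝓛def]
  field_simp

/-- **The `ω₁`-circle evaluation, packaged, u025 form** (the difference of the circle integrals at two lengths
`Y₂`, `Y₁ ∈ [1, P]` against `Π(d,r)L′(1,χ)·β_{j+1}β_{j+2}(Y₂^{β₆−w} − Y₁^{β₆−w})/(β₆−w) = Π L′·circ025`,
`Typed.Sec12B.circ025_eq`): same quantifiers, error `C·𝓛⁻¹⁵·Π̂²`.
[cite: Zhang2022LandauSiegel, §12 proof of Lemma 12.2, p. 69, tex L3534] [cite: Zhang2022LandauSiegel, §5 Lemma 5.7] -/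
theorem circ_omega1_pair_eval_forAllLarge_pow15 (c' C₈₃ : ℝ) :
    ∃ C : ℝ, 0 ≤ C ∧ ForAllLarge fun D _ χ => ‖χ.LFunction 1‖ ≤ 1 / Real.log D ^ 15 →
      ∀ j : ℕ, ∀ d r : ℕ, d ≠ 0 → r ≠ 0 → ∀ U : ℂ → ℂ,
        DifferentiableOn ℂ U {s : ℂ | 9 / 10 < s.re} →
        (∀ s : ℂ, ‖s - 1‖ ≤ 5 * alpha D → ‖U s - PiW χ d r‖ ≤
            C₈₃ * (ell D ^ 8)⁻¹ * ∏ q ∈ (d * r).primeFactors, (1 - (q : ℝ)⁻¹)⁻¹) →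
        ∀ w : ℂ, ‖w‖ = alpha D → ∀ Y₁ Y₂ : ℝ, 1 ≤ Y₁ → Y₁ ≤ bigP D → 1 ≤ Y₂ → Y₂ ≤ bigP D →
          ∀ Λ : ℝ, 1 ≤ Λ →
          ‖((2 * π * I)⁻¹ * (∮ z in C(beta6 D - w, 3 * alpha D),
                U (1 - beta6 D + w + z) * χ.LFunction (1 - beta6 D + w + z + betaJ c' D (j + 1)) *
                    χ.LFunction (1 - beta6 D + w + z + betaJ c' D (j + 2)) /
                    χ.LFunction (1 - beta6 D + w + z) *
                  (((Y₂ : ℝ) : ℂ) ^ (z + 0) * omega1 Λ (z + 0) / (z + 0))) -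
              (2 * π * I)⁻¹ * (∮ z in C(beta6 D - w, 3 * alpha D),
                U (1 - beta6 D + w + z) * χ.LFunction (1 - beta6 D + w + z + betaJ c' D (j + 1)) *
                    χ.LFunction (1 - beta6 D + w + z + betaJ c' D (j + 2)) /
                    χ.LFunction (1 - beta6 D + w + z) *
                  (((Y₁ : ℝ) : ℂ) ^ (z + 0) * omega1 Λ (z + 0) / (z + 0)))) -
              PiW χ d r * deriv χ.LFunction 1 *
                (betaJ c' D (j + 1) * betaJ c' D (j + 2) *
                  ((((Y₂ : ℝ) : ℂ) ^ (beta6 D - w) - ((Y₁ : ℝ) : ℂ) ^ (beta6 D - w)) /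
                    (beta6 D - w)))‖ ≤
            C * (ell D ^ 15)⁻¹ * (∏ q ∈ (d * r).primeFactors, (1 - (q : ℝ)⁻¹)⁻¹) ^ 2 := by
  obtain ⟨C, hC0, D₀, hC⟩ := circ_omega1_eval_forAllLarge_pow15 c' C₈₃
  refine ⟨2 * C, by positivity, D₀, fun D _ χ hD hq hp hA j d r hd hr U hUd hU3 w hw Y₁ Y₂ hY₁ hY₁P
    hY₂ hY₂P Λ hΛ => ?_⟩
  have h₂ := hC D χ hD hq hp hA j d r hd hr U hUd hU3 w hw Y₂ hY₂ hY₂P Λ hΛ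
  have h₁ := hC D χ hD hq hp hA j d r hd hr U hUd hU3 w hw Y₁ hY₁ hY₁P Λ hΛ
  -- abbreviate the values
  set A₂ := (2 * π * I)⁻¹ * (∮ z in C(beta6 D - w, 3 * alpha D),
      U (1 - beta6 D + w + z) * χ.LFunction (1 - beta6 D + w + z + betaJ c' D (j + 1)) *
          χ.LFunction (1 - beta6 D + w + z + betaJ c' D (j + 2)) / χ.LFunction (1 - beta6 D + w + z) *
        (((Y₂ : ℝ) : ℂ) ^ (z + 0) * omega1 Λ (z + 0) / (z + 0))) with hA₂
  set A₁ := (2 * π * I)⁻¹ * (∮ z in C(beta6 D - w, 3 * alpha D),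
      U (1 - beta6 D + w + z) * χ.LFunction (1 - beta6 D + w + z + betaJ c' D (j + 1)) *
          χ.LFunction (1 - beta6 D + w + z + betaJ c' D (j + 2)) / χ.LFunction (1 - beta6 D + w + z) *
        (((Y₁ : ℝ) : ℂ) ^ (z + 0) * omega1 Λ (z + 0) / (z + 0))) with hA₁
  set ellPi : ℂ := PiW χ d r * deriv χ.LFunction 1 with hellPi
  set βa : ℂ := betaJ c' D (j + 1) with hβa
  set βb : ℂ := betaJ c' D (j + 2) with hβb
  set M₂ : ℂ := ellPi * (w - beta6 D + βa + βb + βa * βb * ((((Y₂ : ℝ) : ℂ) ^ (beta6 D - w) - 1) /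
      (beta6 D - w))) with hM₂
  set M₁ : ℂ := ellPi * (w - beta6 D + βa + βb + βa * βb * ((((Y₁ : ℝ) : ℂ) ^ (beta6 D - w) - 1) /
      (beta6 D - w))) with hM₁
  have e : A₂ - A₁ - ellPi * (βa * βb * ((((Y₂ : ℝ) : ℂ) ^ (beta6 D - w) -
      ((Y₁ : ℝ) : ℂ) ^ (beta6 D - w)) / (beta6 D - w))) = (A₂ - M₂) - (A₁ - M₁) := by
    rw [hM₂, hM₁]
    ring
  rw [e]
  refine (norm_sub_le _ _).trans ?_
  have h2C : 2 * C * (ell D ^ 15)⁻¹ * (∏ q ∈ (d * r).primeFactors, (1 - (q : ℝ)⁻¹)⁻¹) ^ 2 =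
      C * (ell D ^ 15)⁻¹ * (∏ q ∈ (d * r).primeFactors, (1 - (q : ℝ)⁻¹)⁻¹) ^ 2 +
        C * (ell D ^ 15)⁻¹ * (∏ q ∈ (d * r).primeFactors, (1 - (q : ℝ)⁻¹)⁻¹) ^ 2 := by ring
  rw [h2C]
  exact add_le_add h₂ h₁

end ShiftedCircleOmegaPow15

end Literature.NumberTheory.LFunctions.Zhang2022.Lemma84

end
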